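import Mathlib

/-!
HONEST FRAMING: exact (Metropolis-corrected) sampling algorithms for lattice gauge theory; figures of
merit are autocorrelation/cost numbers at stated couplings and volumes; no continuum-physics claim.

# AbelianRadius — the U(1) Fourier-side core of THEOREM A (THEORY-1.md §12): Lüscher's
trivializing-flow recursion in Fourier space, the local gradient norm, and the one-step contraction
that gives an L-INDEPENDENT convergence radius

Proposed tree path: `Summits/Ventures/LatticeQCDFlow/TrivializingMaps/AbelianRadius.lean` (OURS — venture
work, never `Literature/`). Cell `lqcd-flow` (pub-lqcd), unit `pub-lqcd-theory1-g3`, 2026-08-21.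

## What is here (statement level + small proved lemmas; Mathlib only)
For compact U(1) lattice gauge theory with the Wilson action `S = β S₁`, `S₁ = -∑_p cos θ_p`, the
normalised Lüscher series `s_k` (`S̃^{(k)} = β^{k+1} s_k`, Lüscher 2010 eqs. (4.12)–(4.13)) is a
trigonometric polynomial `s_k(θ) = ∑_m a^{(k)}_m e^{i m·θ}` over integer link vectors `m : E → ℤ`, and the
recursion `s_k = -Δ⁻¹ P 𝓥_{S₁} s_{k-1}` is the EXPLICIT linear map `stepR` below on finitely supported
coefficient families (THEORY-1 §12.4; checked there against the independent closed form of `s₁`).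
The local gradient norm `locNorm e a = ∑_m |m_e| |a_m|` dominates `sup_θ |∂s/∂θ_e|`
(`abs_gradFormula_le_locNorm`, PROVED). THEOREM A (§12.3–12.4) says `stepR` contracts the sup over
links of `locNorm` by at most `D (1 + 8/g)` (`D` = plaquettes per link, `g` = a lower bound for `c(m) = ∑ m_e²`
on the nonzero modes produced; `g = 4` on tori of side `≥ 4`), whence `locNorm e (a^{(k)}) ≤ (D/4)(3D)^k`
— for the torus `(ℤ/L)^d` (`D = 2(d-1)`): `|∂_e s_k| ≤ ((d-1)/2) (6(d-1))^k`, radius `tβ ≥ 1/(6(d-1))`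
uniformly in `L`. BOTH STATEMENTS ARE PROVED IN THIS FILE (kernel-checked, 0 sorries, Mathlib only):
`abelianStepContraction : AbelianStepContraction K` (§12.3 Parts A/B verbatim) and
`abelianGeometricGradientBound : AbelianGeometricGradientBound K` (support invariance on the boundary lattice +
girth + induction), over an ABSTRACT finite plaquette complex `K` so that no lattice geometry has to be formalised
first; the only remaining instance work is the torus complex and its girth-4 property for `L ≥ 4` (row R-T1-10b).

References: M. Lüscher, Commun. Math. Phys. 293 (2010) 899 [arXiv:0907.5491], §4.2–4.5 (bib
`Luscher2010Trivializing`); THEORY-1.md §10.6 (exact low orders, 2-d U(1)), §12 (Theorem A).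
-/

namespace Summit.Ventures.LatticeQCDFlow.TrivializingMaps.Abelian

open Finset

/-- Integer Fourier modes on the set of links `E` (`e^{i m·θ}`, `m : E → ℤ`). -/
abbrev Mode (E : Type*) := E → ℤ

section Modes

variable {E : Type*} [Fintype E]

/-- `c(m) = ∑_e m_e²` — the eigenvalue of Lüscher's `Δ = -∑_e ∂²/∂θ_e²` on the mode `e^{i m·θ}`. -/
def normSq (m : Mode E) : ℤ := ∑ e, m e ^ 2

/-- `‖m‖₁ = ∑_e |m_e|` — the total weight `|m|` of THEORY-1 §12.2 in the U(1) case. -/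
def l1 (m : Mode E) : ℤ := ∑ e, |m e|

/-- `⟨χ, m⟩ = ∑_e χ_e m_e` (for a plaquette boundary `χ = χ_p`: `∑_{e ∈ p} ± m_e`). -/
def pair (χ m : Mode E) : ℤ := ∑ e, χ e * m e

/-- `‖m‖₁ ≤ c(m)` for integer modes (THEORY-1 §12.4, the U(1) form of `c(π) ≥ κ|π|` with `κ = 1`): termwise
`|x| ≤ x²` on `ℤ` — why dividing by the Laplacian eigenvalue pays for one power of the weight. (The integer
lemma is the tree's `Literature.NumberTheory.EllipticCurves.Tunnell1983.abs_le_sq`; it is re-derived inline here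
to keep this file's import closure at `Mathlib`.) [folklore] -/
theorem l1_le_normSq (m : Mode E) : l1 m ≤ normSq m := by
  refine Finset.sum_le_sum fun e _ => ?_
  rcases eq_or_ne (m e) 0 with h | h
  · simp [h]
  · have h1 : 1 ≤ |m e| := Int.one_le_abs h
    calc |m e| = |m e| * 1 := by ring
      _ ≤ |m e| * |m e| := mul_le_mul_of_nonneg_left h1 (abs_nonneg _)
      _ = m e ^ 2 := by rw [abs_mul_abs_self, sq]

/-- `c(m) ≥ 0`. [folklore] -/
theorem normSq_nonneg (m : Mode E) : 0 ≤ normSq m :=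
  Finset.sum_nonneg fun e _ => sq_nonneg (m e)

/-- `‖m‖₁ ≥ 0`. [folklore] -/
theorem l1_nonneg (m : Mode E) : 0 ≤ l1 m :=
  Finset.sum_nonneg fun e _ => abs_nonneg (m e)

/-- `c(m) = 0` iff `m` is the zero mode (the constants = kernel of `Δ`). [folklore] -/
theorem normSq_eq_zero_iff (m : Mode E) : normSq m = 0 ↔ m = 0 := by
  constructor
  · intro h
    have hall := (Finset.sum_eq_zero_iff_of_nonneg (fun e _ => sq_nonneg (m e))).1 h
    funext e
    exact pow_eq_zero_iff (two_ne_zero) |>.1 (hall e (Finset.mem_univ e))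
  · rintro rfl
    simp [normSq]

/-- A nonzero integer mode has `c(m) ≥ 1` (the `g = 1`, all-volume version of the girth bound). -/
theorem one_le_normSq {m : Mode E} (hm : m ≠ 0) : 1 ≤ normSq m := by
  have h0 := normSq_nonneg m
  have hne : normSq m ≠ 0 := fun h => hm ((normSq_eq_zero_iff m).1 h)
  omega

/-- The ℓ¹ shift inequality `‖n‖₁ - ‖χ‖₁ ≤ ‖n + χ‖₁` (attaching a plaquette, `‖χ_p‖₁ = 4`, lowers the total
weight by at most 4 — THEORY-1 §12.3 (1)(ii) with `σ_F = 1`). -/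
theorem l1_sub_le_l1_add (n χ : Mode E) : l1 n - l1 χ ≤ l1 (n + χ) := by
  unfold l1
  rw [← Finset.sum_sub_distrib]
  refine Finset.sum_le_sum fun e _ => ?_
  have h := abs_sub_abs_le_abs_sub (n e) (-χ e)
  simpa only [abs_neg, sub_neg_eq_add, Pi.add_apply] using h

/-- Same for `n - χ`. -/
theorem l1_sub_le_l1_sub (n χ : Mode E) : l1 n - l1 χ ≤ l1 (n - χ) := by
  unfold l1
  rw [← Finset.sum_sub_distrib]
  refine Finset.sum_le_sum fun e _ => ?_
  simpa only [Pi.sub_apply] using abs_sub_abs_le_abs_sub (n e) (χ e)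

omit [Fintype E] in
/-- Coordinates move by at most `|χ_e| ≤ 1` when a plaquette is attached (§12.3 (1)(i), `σ_F = 1`). -/
theorem abs_add_apply_le (n χ : Mode E) (e : E) : |(n + χ) e| ≤ |n e| + |χ e| := by
  simpa only [Pi.add_apply] using abs_add_le (n e) (χ e)

/-- `|⟨χ, n⟩| ≤ ∑_e |χ_e| |n_e|` (so `≤ ∑_{e ∈ p} |n_e|` for a plaquette boundary). -/
theorem abs_pair_le (χ n : Mode E) : |pair χ n| ≤ ∑ e, |χ e| * |n e| := by
  unfold pair
  refine (Finset.abs_sum_le_sum_abs _ _).trans ?_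
  exact Finset.sum_le_sum fun e _ => by rw [abs_mul]

end Modes

/-! ## The plaquette complex, the explicit recursion, the local norm -/

/-- A finite PLAQUETTE COMPLEX for compact U(1): links `E`, plaquettes `P`, the oriented boundary
`χ p : E → ℤ` of each plaquette with entries in `{0, ±1}` and at most four links (`‖χ_p‖₁ ≤ 4`; on a
torus with `L ≥ 2` it is exactly four), and a bound `D` on the
number of plaquettes through a link. Instance of record: the periodic torus `(ℤ/L)^d`, `L ≥ 2`, with
`χ_{(x,μ<ν)} = δ_{(x,μ)} + δ_{(x+μ̂,ν)} - δ_{(x+ν̂,μ)} - δ_{(x,ν)}` and `D = 2(d-1)`. -/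
structure PlaquetteComplex (E P : Type*) [Fintype E] [Fintype P] where
  /-- oriented plaquette boundaries -/
  χ : P → Mode E
  /-- entries in `{0, ±1}` -/
  abs_χ_le : ∀ p e, |χ p e| ≤ 1
  /-- at most four links per plaquette (`‖χ_p‖₁ ≤ 4`) -/
  l1_χ_le : ∀ p, l1 (χ p) ≤ 4
  /-- at most `D` plaquettes through any link -/
  D : ℕ
  card_filter_le : ∀ e, (Finset.univ.filter fun p => χ p e ≠ 0).card ≤ D

variable {E P : Type*} [Fintype E] [Fintype P]

noncomputable section

/-- Finitely supported real coefficient families `(a_m)_{m ∈ ℤ^E}` — the Fourier side of the algebra `𝒫`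
of trigonometric polynomials in the link angles. -/
abbrev Coeffs (E : Type*) := Mode E →₀ ℝ

/-- ONE LÜSCHER STEP IN FOURIER SPACE, `b = -Δ⁻¹ P 𝓥_{S₁} f` for `S₁ = -∑_p cos(χ_p·θ)`:
with `f = ∑_n a_n e^{i n·θ}`, `𝓥_{S₁} f = ∑_p (∂S₁/∂θ)·(∂f/∂θ)` has coefficient `± ⟨χ_p, n⟩ a_n / 2` at
`m = n ± χ_p`, and `-Δ⁻¹P` divides by `-c(m)`; so
`b = ∑_n ∑_p (⟨χ_p,n⟩ a_n / 2) · ( δ_{n-χ_p} / c(n-χ_p) - δ_{n+χ_p} / c(n+χ_p) )`,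
the zero mode dropping out automatically (`(0:ℝ)⁻¹ = 0` implements the projection `P`). Equivalently
`b_m = -(1/(2c(m))) ∑_p [ (⟨χ_p,m⟩-4) a_{m-χ_p} - (⟨χ_p,m⟩+4) a_{m+χ_p} ]` (THEORY-1 §12.4; reproduces the
order-1 coefficients `1/32, -1/24, 1/40` of §10.6). [ours; cite: Luscher2010Trivializing §4.3 (4.12)–(4.13)] -/
def stepR (K : PlaquetteComplex E P) (a : Coeffs E) : Coeffs E :=
  a.sum fun n an => ∑ p : P, ((pair (K.χ p) n : ℝ) * an / 2) •
    (Finsupp.single (n - K.χ p) ((normSq (n - K.χ p) : ℝ)⁻¹) -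
      Finsupp.single (n + K.χ p) ((normSq (n + K.χ p) : ℝ)⁻¹))

/-- THE NORMALISED LÜSCHER COEFFICIENTS `a^{(k)}`: `s₀ = Δ⁻¹P S₁ = -(1/4)∑_p cos θ_p`, i.e.
`a^{(0)} = -1/8` on `± χ_p`, and `a^{(k+1)} = stepR a^{(k)}`. -/
def luscherCoeffs (K : PlaquetteComplex E P) : ℕ → Coeffs E
  | 0 => ∑ p : P, (-(1 / 8 : ℝ)) • (Finsupp.single (K.χ p) 1 + Finsupp.single (-K.χ p) 1)
  | k + 1 => stepR K (luscherCoeffs K k)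

/-- LOCAL GRADIENT NORM at the link `e`: `N_e(a) = ∑_m |m_e| |a_m|` (THEORY-1 §12.2; for U(1) it equals
the "per-link gradient ℓ¹-majorant" `g_k` of §10.6 when `a = a^{(k)}`: `1/2, 23/40, 411/640, …`). -/
def locNorm (e : E) (a : Coeffs E) : ℝ :=
  a.sum fun n an => |(n e : ℝ)| * |an|

omit [Fintype E] in
/-- `N_e(a) ≥ 0`. [folklore] -/
theorem locNorm_nonneg (e : E) (a : Coeffs E) : 0 ≤ locNorm e a :=
  Finset.sum_nonneg fun _ _ => mul_nonneg (abs_nonneg _) (abs_nonneg _)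

omit [Fintype E] in
/-- The gradient formula is dominated by the local norm: for `s(θ) = ∑_m a_m cos(m·θ + φ_m)` one has
`∂s/∂θ_e = -∑_m a_m m_e sin(m·θ + φ_m)` and `|∂s/∂θ_e| ≤ N_e(a)` — here in the form actually used,
for an arbitrary phase function (PROVED). [folklore] -/
theorem abs_gradFormula_le_locNorm (e : E) (a : Coeffs E) (phase : Mode E → ℝ) :
    |a.sum fun n an => -(an * (n e : ℝ) * Real.sin (phase n))| ≤ locNorm e a := by
  unfold locNorm Finsupp.sum
  refine (Finset.abs_sum_le_sum_abs _ _).trans (Finset.sum_le_sum fun n _ => ?_)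
  rw [abs_neg, abs_mul, abs_mul]
  calc |a n| * |(n e : ℝ)| * |Real.sin (phase n)|
      ≤ |a n| * |(n e : ℝ)| * 1 := by
        gcongr
        exact Real.abs_sin_le_one _
    _ = |(n e : ℝ)| * |a n| := by ring

/-! ## The two statements of THEOREM A in the U(1) case (proved in the last two sections of this file) -/

/-- Girth hypothesis at level `g` for the family `a`: every NONZERO mode produced from a mode of `a` by
attaching one plaquette has Laplacian eigenvalue `c(m) ≥ g`. Always true with `g = 1` (`one_le_normSq`);
true with `g = 4` on tori of side `≥ 4` for families supported on integer 1-cycles (a nonzero cycle has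
`≥ 4` links). -/
def GirthAt (K : PlaquetteComplex E P) (g : ℕ) (a : Coeffs E) : Prop :=
  ∀ n ∈ a.support, ∀ (p : P) (m : Mode E), (m = n + K.χ p ∨ m = n - K.χ p) → m ≠ 0 → (g : ℤ) ≤ normSq m

/-- **One-step contraction (THEORY-1 §12.3, U(1))** — OURS; PROVED below (`abelianStepContraction`).
If every link norm of `a` is `≤ M` and the girth hypothesis holds at level `g ≥ 1`, then every link norm of
`stepR a` is `≤ D (1 + 8/g) M`. Proof (paper and Lean): PART A (weight at `e` inherited from `n`): per term the ratio
`|n_e| ‖n‖₁ / max(g, ‖n‖₁ - 4)` summed with `∑_{(p,e') : e' ∈ p} |n_{e'}| = D ‖n‖₁` gives `D · sup_s s/max(g,s-4)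
= D (1 + 4/g)`; PART B (weight created at `e` by the `≤ D` plaquettes through `e`, each with 4 links): `4D/g`.
With `g = 4`: factor `3D` (`= 6(d-1)` on the torus). [ours] -/
def AbelianStepContraction (K : PlaquetteComplex E P) : Prop :=
  ∀ (g : ℕ), 1 ≤ g → ∀ (a : Coeffs E) (M : ℝ), GirthAt K g a → (∀ e, locNorm e a ≤ M) →
    ∀ e, locNorm e (stepR K a) ≤ (K.D : ℝ) * (1 + 8 / (g : ℝ)) * M

/-- The torus girth-4 property as a hypothesis on the complex: every nonzero element of the lattice
generated by the plaquette boundaries (where all `a^{(k)}` are supported) has `c(m) ≥ 4`. Holds for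
`(ℤ/L)^d`, `L ≥ 4` (boundaries are 1-cycles; a nonzero integer 1-cycle contains a graph cycle, of length
`≥ 4`). -/
def CycleGirthFour (K : PlaquetteComplex E P) : Prop :=
  ∀ m ∈ AddSubgroup.closure (Set.range K.χ), m ≠ 0 → (4 : ℤ) ≤ normSq m

/-- **Volume-uniform geometric gradient bound (THEOREM A, U(1) line; THEORY-1 §12.4)** — OURS; PROVED below
(`abelianGeometricGradientBound`).
Under the girth-4 property, `N_e(a^{(k)}) ≤ (D/4) · (3D)^k` for all `k` and all links: with `D = 2(d-1)` this is
`|∂_e s_k| ≤ ((d-1)/2) (6(d-1))^k`, i.e. the gradient series of Lüscher's expansion for `β S₁` converges for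
`|t| β < 1/(6(d-1))` INDEPENDENTLY OF THE LATTICE SIZE — the U(1) analogue of the venture conjecture
`LuscherGeometricGradientBound` (C1′), there stated for `SU(n)`. Route: `N_e(a^{(0)}) ≤ D · 2 · (1/8)`, then
`AbelianStepContraction` with `g = 4` and support invariance (`stepR` maps families supported on the boundary
lattice to such families). Consistency: the exact 2-d data of THEORY-1 §10.6 have `N_e(a^{(k)}) ∈ [0.50, 0.77]`
for `k ≤ 7` against the bound `(1/2)·6^k`. [ours] -/
def AbelianGeometricGradientBound (K : PlaquetteComplex E P) : Prop :=
  CycleGirthFour K → ∀ (k : ℕ) (e : E), locNorm e (luscherCoeffs K k) ≤ (K.D : ℝ) / 4 * (3 * K.D) ^ k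

/-- The elementary real inequality behind PART A: `s / max(g, s - 4) ≤ 1 + 4/g` for `g ≥ 1` (all real `s`;
used for `s = ‖n‖₁ ≥ 0`) (PROVED). [folklore] -/
theorem ratio_le (g s : ℝ) (hg : 1 ≤ g) : s / max g (s - 4) ≤ 1 + 4 / g := by
  have hgpos : 0 < g := lt_of_lt_of_le one_pos hg
  have hmax : 0 < max g (s - 4) := lt_max_of_lt_left hgpos
  rw [div_le_iff₀ hmax]
  rcases le_or_gt (s - 4) g with h | h
  · rw [max_eq_left h]
    have : s ≤ g + 4 := by linarith
    calc s ≤ g + 4 := this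
      _ = (1 + 4 / g) * g := by field_simp
  · rw [max_eq_right h.le]
    have h4g : 4 / g * (s - 4) ≥ 4 := by
      have : g ≤ s - 4 := h.le
      have h1 : 4 / g * (s - 4) ≥ 4 / g * g :=
        mul_le_mul_of_nonneg_left this (by positivity)
      have h2 : 4 / g * g = 4 := by field_simp
      linarith
    nlinarith

end

end Summit.Ventures.LatticeQCDFlow.TrivializingMaps.Abelian
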